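import Literature.Geometry.Riemannian.ColdingMinicozziEntropy
import HarnessLib

/-!
# Gaussian areas under bi-Lipschitz distortion: the upper comparison

Mirror image of `GaussianAreaDistortion.lean` (which bounds the Gaussian area of a
`(1 ± ε)`-bi-Lipschitz image from BELOW): here the bound from ABOVE, used for the upper half of
Colding–Minicozzi 2012, Lemma 7.2 (3) (`F_{x₀,t₀}(Σ) → 1` as `t₀ → 0`, `x₀ ∈ Σ`) in
`ColdingMinicozziEntropyDensity.lean`:

* `euclideanHausdorffMeasure_image_le_of_dist_le_mul` — `μHE[d](h(S)) ≤ L^d μHE[d](S)` for an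
  `L`-Lipschitz `h` on `S` (Federer 2.10.11);
* `gaussianArea_image_le` — if `h : T → F` is `(1+ε)`-Lipschitz and `(1-ε)`-co-Lipschitz on
  `ball 0 r`, then `F_{h 0, t}(h(B_r)) ≤ ((1+ε)/(1-ε))ⁿ · F^T_{0, t/(1-ε)²}(B_r)` for all `t > 0`
  (`lintegral_gaussianWeight_image_le`: layer cake on both sides, super-level sets = balls).

Everything is proved; no definitions and no named facts are introduced.

## References

* T. H. Colding, W. P. Minicozzi II, *Generic mean curvature flow I; generic singularities*,
  Ann. of Math. 175 (2012) 755–833, Lemma 7.2. [ColdingMinicozzi2012]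
* H. Federer, *Geometric Measure Theory* (1969), 2.10.11. [Federer1969]
-/

noncomputable section

open Set Function Filter Module Metric
open _root_.MeasureTheory _root_.MeasureTheory.Measure
open scoped ENNReal NNReal Topology

namespace Literature.Geometry.Riemannian

/-! ### Lipschitz images and `μHE` -/

section LipschitzMeasure

variable {X Y : Type*} [MetricSpace X] [MeasurableSpace X] [BorelSpace X]
  [MetricSpace Y] [MeasurableSpace Y] [BorelSpace Y]

/-- **Lipschitz maps increase `μHE[d]` by at most `L^d`** (real constant form of Federer
2.10.11 / Mathlib's `LipschitzOnWith.hausdorffMeasure_image_le`, for the Euclidean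
normalisation): if `dist (h y) (h z) ≤ L · dist y z` on `S` then
`μHE[d] (h '' S) ≤ ENNReal.ofReal (L^d) · μHE[d] S`. [cite: Federer1969, 2.10.11] -/
theorem euclideanHausdorffMeasure_image_le_of_dist_le_mul {h : X → Y} {S : Set X} {L : ℝ}
    (hL : 0 ≤ L) (hlip : ∀ y ∈ S, ∀ z ∈ S, dist (h y) (h z) ≤ L * dist y z) (d : ℕ) :
    (μHE[d] : Measure Y) (h '' S) ≤ ENNReal.ofReal (L ^ d) * (μHE[d] : Measure X) S := by
  have hlip' : LipschitzOnWith L.toNNReal h S := by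
    refine LipschitzOnWith.of_dist_le_mul fun y hy z hz => ?_
    rw [Real.coe_toNNReal _ hL]
    exact hlip y hy z hz
  have key := hlip'.hausdorffMeasure_image_le (Nat.cast_nonneg d)
  have hcoe : ((L.toNNReal : ℝ≥0) : ℝ≥0∞) ^ (d : ℝ) = ENNReal.ofReal (L ^ d) := by
    rw [ENNReal.rpow_natCast, ENNReal.ofReal_pow hL]
    rfl
  rw [hcoe] at key
  rw [euclideanHausdorffMeasure_def, euclideanHausdorffMeasure_def, Measure.smul_apply,
    Measure.smul_apply, ENNReal.smul_def, ENNReal.smul_def, smul_eq_mul, smul_eq_mul,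
    mul_left_comm]
  exact mul_le_mul' le_rfl key

end LipschitzMeasure

/-! ### Upper distortion comparison -/

section UpperDistortion

variable {T : Type*} [NormedAddCommGroup T] [MeasurableSpace T] [BorelSpace T]
  {F : Type*} [NormedAddCommGroup F] [MeasurableSpace F] [BorelSpace F]

/-- The identity of normalising factors
`((1-ε)/(1+ε))ⁿ (4π t/(1+ε)²)^{-n/2} = (4πt)^{-n/2} (1-ε)ⁿ` for every `ε > -1` (the version of
`distortion_normalization_identity` in `GaussianAreaDistortion.lean` assumed `ε > 0`; with
`ε ↦ -ε` it serves the upper comparison). [folklore] -/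
theorem distortion_normalization_identity' (n : ℕ) {ε t : ℝ} (hε : -1 < ε) (ht : 0 < t) :
    ((1 - ε) / (1 + ε)) ^ n * (4 * Real.pi * (t / (1 + ε) ^ 2)) ^ (-(n : ℝ) / 2) =
      (4 * Real.pi * t) ^ (-(n : ℝ) / 2) * (1 - ε) ^ n := by
  have ha : 0 < 1 + ε := by linarith
  have h2 : ((1 + ε) ^ 2) ^ ((n : ℝ) / 2) = (1 + ε) ^ n := by
    rw [← Real.rpow_natCast (1 + ε) 2, ← Real.rpow_mul ha.le, Nat.cast_ofNat,
      show (2 : ℝ) * ((n : ℝ) / 2) = n by ring, Real.rpow_natCast]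
  have h1 : (4 * Real.pi * (t / (1 + ε) ^ 2)) ^ (-(n : ℝ) / 2) =
      (4 * Real.pi * t) ^ (-(n : ℝ) / 2) * (1 + ε) ^ n := by
    rw [show 4 * Real.pi * (t / (1 + ε) ^ 2) = (4 * Real.pi * t) * ((1 + ε) ^ 2)⁻¹ by ring,
      Real.mul_rpow (by positivity) (by positivity), Real.inv_rpow (by positivity), neg_div,
      Real.rpow_neg (by positivity : (0 : ℝ) ≤ (1 + ε) ^ 2), inv_inv, h2]
  rw [h1, div_pow]
  field_simp

/-- **Core upper comparison.** Let `h : T → F` be `(1+ε)`-Lipschitz and `(1-ε)`-co-Lipschitz on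
`B_r = ball 0 r ⊆ T` (`0 < ε < 1`, `r > 0`). Then for `t > 0`
`∫_{h(B_r)} e^{-‖y - h 0‖²/4t} dμHE[n] ≤ (1+ε)ⁿ ∫_{B_r} e^{-‖v‖²/4t''} dμHE[n]`, `t'' = t/(1-ε)²`:
layer cake on both sides; for `0 < s < 1` the super-level sets are the balls of radii
`R = √(4t log(1/s))` around `h 0` and `R'' = R/(1-ε)` in `T`; `B(h 0, R) ∩ h(B_r) ⊆ h(B_r ∩ B_{R''})`
by the co-Lipschitz bound, and `μHE[n](h(S)) ≤ (1+ε)ⁿ μHE[n](S)` by the Lipschitz bound.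
(Mirror image of `lintegral_gaussianWeight_image_ge`.) [cite: ColdingMinicozzi2012, Lemma 7.2] -/
theorem lintegral_gaussianWeight_image_le {n : ℕ} {h : T → F} {ε r : ℝ} (hε : 0 < ε) (hε1 : ε < 1)
    (hr : 0 < r)
    (hlip : ∀ v ∈ ball (0 : T) r, ∀ w ∈ ball (0 : T) r, ‖h v - h w‖ ≤ (1 + ε) * ‖v - w‖)
    (hco : ∀ v ∈ ball (0 : T) r, ∀ w ∈ ball (0 : T) r, (1 - ε) * ‖v - w‖ ≤ ‖h v - h w‖)
    {t : ℝ} (ht : 0 < t) :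
    ∫⁻ y in h '' ball (0 : T) r, gaussianWeight (h 0) t y ∂(μHE[n] : Measure F) ≤
      ENNReal.ofReal ((1 + ε) ^ n) *
        ∫⁻ v in ball (0 : T) r, gaussianWeight (0 : T) (t / (1 - ε) ^ 2) v ∂(μHE[n] : Measure T) := by
  have ha : 0 < 1 + ε := by linarith
  have hc : 0 < 1 - ε := by linarith
  set S := ball (0 : T) r with hS
  set t' := t / (1 - ε) ^ 2 with ht'
  have ht'pos : 0 < t' := by positivity
  have hlevelT : ∀ (p : T) {τ : ℝ}, 0 < τ → ∀ {s : ℝ}, 0 < s →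
      {x : T | s < Real.exp (-(‖x - p‖ ^ 2) / (4 * τ))} = ball p (Real.sqrt (4 * τ * -Real.log s)) := by
    intro p τ hτ s hs
    ext x
    rw [mem_setOf_eq, mem_ball, dist_eq_norm, ← Real.log_lt_iff_lt_exp hs,
      Real.lt_sqrt (norm_nonneg _), lt_div_iff₀ (by positivity : (0 : ℝ) < 4 * τ)]
    constructor <;> intro h <;> nlinarith
  have hlevelF : ∀ (p : F) {τ : ℝ}, 0 < τ → ∀ {s : ℝ}, 0 < s →
      {x : F | s < Real.exp (-(‖x - p‖ ^ 2) / (4 * τ))} = ball p (Real.sqrt (4 * τ * -Real.log s)) := by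
    intro p τ hτ s hs
    ext x
    rw [mem_setOf_eq, mem_ball, dist_eq_norm, ← Real.log_lt_iff_lt_exp hs,
      Real.lt_sqrt (norm_nonneg _), lt_div_iff₀ (by positivity : (0 : ℝ) < 4 * τ)]
    constructor <;> intro h <;> nlinarith
  have hemptyF : ∀ {s : ℝ}, 1 ≤ s →
      {y : F | s < Real.exp (-(‖y - h 0‖ ^ 2) / (4 * t))} = ∅ := by
    intro s hs1
    ext y
    simp only [mem_setOf_eq, mem_empty_iff_false, iff_false, not_lt]
    refine (Real.exp_le_one_iff.2 ?_).trans hs1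
    exact div_nonpos_of_nonpos_of_nonneg (neg_nonpos.2 (sq_nonneg _)) (by positivity)
  set μF : Measure F := (μHE[n] : Measure F).restrict (h '' S) with hμF
  set μT : Measure T := (μHE[n] : Measure T).restrict S with hμT
  have hlayF : ∫⁻ y in h '' S, gaussianWeight (h 0) t y ∂(μHE[n] : Measure F) =
      ∫⁻ s in Ioi 0, μF {y : F | s < Real.exp (-(‖y - h 0‖ ^ 2) / (4 * t))} :=
    lintegral_eq_lintegral_meas_lt μF (f := fun y : F => Real.exp (-(‖y - h 0‖ ^ 2) / (4 * t)))
      (Eventually.of_forall fun y => (Real.exp_pos _).le) (by fun_prop)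
  have hlayT : ∫⁻ v in S, gaussianWeight (0 : T) t' v ∂(μHE[n] : Measure T) =
      ∫⁻ s in Ioi 0, μT {v : T | s < Real.exp (-(‖v - 0‖ ^ 2) / (4 * t'))} :=
    lintegral_eq_lintegral_meas_lt μT (f := fun v : T => Real.exp (-(‖v - 0‖ ^ 2) / (4 * t')))
      (Eventually.of_forall fun v => (Real.exp_pos _).le) (by fun_prop)
  -- pointwise comparison for all `s > 0`
  have hpt : ∀ s ∈ Ioi (0 : ℝ),
      μF {y : F | s < Real.exp (-(‖y - h 0‖ ^ 2) / (4 * t))} ≤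
        ENNReal.ofReal ((1 + ε) ^ n) * μT {v : T | s < Real.exp (-(‖v - 0‖ ^ 2) / (4 * t'))} := by
    intro s hs
    rw [mem_Ioi] at hs
    rcases le_or_gt 1 s with hs1 | hs1
    · rw [hemptyF hs1, measure_empty]
      exact bot_le
    have hlog : 0 ≤ -Real.log s := neg_nonneg.2 (Real.log_nonpos hs.le hs1.le)
    set R := Real.sqrt (4 * t * -Real.log s) with hR
    set R' := Real.sqrt (4 * t' * -Real.log s) with hR'
    have hRR' : R' = R / (1 - ε) := by
      rw [hR, hR', ht', show 4 * (t / (1 - ε) ^ 2) * -Real.log s =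
        (4 * t * -Real.log s) / (1 - ε) ^ 2 by ring, Real.sqrt_div (by positivity),
        Real.sqrt_sq hc.le]
    rw [hlevelT (0 : T) ht'pos hs, hlevelF (h 0) ht hs, hμT, hμF,
      Measure.restrict_apply measurableSet_ball, Measure.restrict_apply measurableSet_ball,
      ← hR, ← hR']
    -- `ball (h 0) R ∩ h '' S ⊆ h '' (ball 0 R' ∩ S)`
    have hsub : ball (h 0) R ∩ h '' S ⊆ h '' (ball 0 R' ∩ S) := by
      rintro _ ⟨hyR, v, hvS, rfl⟩
      refine ⟨v, ⟨?_, hvS⟩, rfl⟩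
      rw [mem_ball, dist_eq_norm, sub_zero, hRR', lt_div_iff₀ hc, mul_comm]
      have h0S : (0 : T) ∈ S := mem_ball_self hr
      calc (1 - ε) * ‖v‖ = (1 - ε) * ‖v - 0‖ := by rw [sub_zero]
        _ ≤ ‖h v - h 0‖ := hco v hvS 0 h0S
        _ < R := by rwa [mem_ball, dist_eq_norm] at hyR
    refine (measure_mono hsub).trans ?_
    have hlipS : ∀ y ∈ ball (0 : T) R' ∩ S, ∀ z ∈ ball (0 : T) R' ∩ S,
        dist (h y) (h z) ≤ (1 + ε) * dist y z := by
      intro y hy z hz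
      rw [dist_eq_norm, dist_eq_norm]
      exact hlip y hy.2 z hz.2
    exact euclideanHausdorffMeasure_image_le_of_dist_le_mul ha.le hlipS n
  calc ∫⁻ y in h '' S, gaussianWeight (h 0) t y ∂(μHE[n] : Measure F)
      = ∫⁻ s in Ioi 0, μF {y : F | s < Real.exp (-(‖y - h 0‖ ^ 2) / (4 * t))} := hlayF
    _ ≤ ∫⁻ s in Ioi 0, ENNReal.ofReal ((1 + ε) ^ n) *
          μT {v : T | s < Real.exp (-(‖v - 0‖ ^ 2) / (4 * t'))} := setLIntegral_mono' measurableSet_Ioi hpt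
    _ = ENNReal.ofReal ((1 + ε) ^ n) *
          ∫⁻ s in Ioi 0, μT {v : T | s < Real.exp (-(‖v - 0‖ ^ 2) / (4 * t'))} := by
        rw [lintegral_const_mul' _ _ ENNReal.ofReal_ne_top]
    _ = ENNReal.ofReal ((1 + ε) ^ n) *
          ∫⁻ v in S, gaussianWeight (0 : T) t' v ∂(μHE[n] : Measure T) := by rw [hlayT]

/-- **Upper distortion comparison of Gaussian areas**: under the hypotheses of
`lintegral_gaussianWeight_image_le`,
`F_{h 0, t}(h(B_r)) ≤ ((1+ε)/(1-ε))ⁿ · F_{0, t/(1-ε)²}(B_r)` (Gaussian area in `F` on the left, in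
`T` on the right) — together with `gaussianArea_image_ge` this pins `F_{h 0,t}(h(B_r))` between
`((1∓ε)/(1±ε))ⁿ` times flat Gaussian areas. [cite: ColdingMinicozzi2012, Lemma 7.2] -/
theorem gaussianArea_image_le {n : ℕ} {h : T → F} {ε r : ℝ} (hε : 0 < ε) (hε1 : ε < 1)
    (hr : 0 < r)
    (hlip : ∀ v ∈ ball (0 : T) r, ∀ w ∈ ball (0 : T) r, ‖h v - h w‖ ≤ (1 + ε) * ‖v - w‖)
    (hco : ∀ v ∈ ball (0 : T) r, ∀ w ∈ ball (0 : T) r, (1 - ε) * ‖v - w‖ ≤ ‖h v - h w‖)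
    {t : ℝ} (ht : 0 < t) :
    gaussianArea n (h 0) t (h '' ball (0 : T) r) ≤
      ENNReal.ofReal (((1 + ε) / (1 - ε)) ^ n) * gaussianArea n (0 : T) (t / (1 - ε) ^ 2) (ball 0 r) := by
  have key := lintegral_gaussianWeight_image_le (n := n) hε hε1 hr hlip hco ht
  rw [gaussianArea_eq, gaussianArea_eq, gaussianNormalization, gaussianNormalization]
  -- `((1+ε)/(1-ε))ⁿ (4π t/(1-ε)²)^{-n/2} = (4πt)^{-n/2} (1+ε)ⁿ`: the identity with `ε ↦ -ε`
  have hnorm : ENNReal.ofReal (((1 + ε) / (1 - ε)) ^ n) *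
      ENNReal.ofReal ((4 * Real.pi * (t / (1 - ε) ^ 2)) ^ (-(n : ℝ) / 2)) =
        ENNReal.ofReal ((4 * Real.pi * t) ^ (-(n : ℝ) / 2)) * ENNReal.ofReal ((1 + ε) ^ n) := by
    have ha : 0 ≤ 1 + ε := by linarith
    have hid := distortion_normalization_identity' n (ε := -ε) (by linarith) ht
    simp only [sub_neg_eq_add] at hid
    rw [show (1 + -ε) = (1 - ε) by ring] at hid
    rw [← ENNReal.ofReal_mul (pow_nonneg (div_nonneg ha (by linarith)) n),
      ← ENNReal.ofReal_mul (Real.rpow_nonneg (by positivity) _), hid]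
  calc ENNReal.ofReal ((4 * Real.pi * t) ^ (-(n : ℝ) / 2)) *
        ∫⁻ y in h '' ball (0 : T) r, gaussianWeight (h 0) t y ∂(μHE[n] : Measure F)
      ≤ ENNReal.ofReal ((4 * Real.pi * t) ^ (-(n : ℝ) / 2)) * (ENNReal.ofReal ((1 + ε) ^ n) *
          ∫⁻ v in ball (0 : T) r, gaussianWeight (0 : T) (t / (1 - ε) ^ 2) v ∂(μHE[n] : Measure T)) :=
        mul_le_mul' le_rfl key
    _ = ENNReal.ofReal (((1 + ε) / (1 - ε)) ^ n) *
          (ENNReal.ofReal ((4 * Real.pi * (t / (1 - ε) ^ 2)) ^ (-(n : ℝ) / 2)) *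
            ∫⁻ v in ball (0 : T) r, gaussianWeight (0 : T) (t / (1 - ε) ^ 2) v ∂(μHE[n] : Measure T)) := by
        rw [← mul_assoc, ← hnorm, mul_assoc]

end UpperDistortion

end Literature.Geometry.Riemannian

end
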